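import Mathlib
import HarnessLib
import Summits.HubbardSuperconductivity.HubbardSuperconductivity.Theorems.KLProgrammeKLRegimeEngineSliceSpaceMomentOscScaleWt
import Summits.HubbardSuperconductivity.HubbardSuperconductivity.Theorems.KLProgrammeKLRegimeEngineCDThresholdsLow
import Summits.HubbardSuperconductivity.HubbardSuperconductivity.Theorems.KLProgrammeKLRegimeEngineCDThresholdsX3

/-!
# KL programme — K3 ENGINE child (`KLRegimeEngineV17F2`, stmt-HubbardSuperconductivity-20437), stub (b) weighted lines, cure (c-D), (K5′) MEAN-FREE
# ORGANISATION: the telescoped weighted rows AT THE (c-D) DEPTH `m₀(j) = 2j+5+⌈log₄U⁻²⌉` — the five thresholds DISCHARGED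

Cell `gate-hubbard-kl`, seat hubbard-kl-k3c3-p2 (g9); token #19 (K5′) ≡ 1 final ((R68)).  `…EngineSliceSpaceMomentOscScaleWt.rowSum_klScaleWt_flowOsc_telescope_le`
∘ `…EngineCDThresholds{Low,X3}.cd_threshold_*` ∘ `cd_depth_lower`: for the slice `(Λ_j, Λ′]`, `Λ_j = klScale klE0 j`, and any base depth
`m₀ ≥ 2j + 5 + ⌈log₄(U²)⁻¹⌉₊`, the threshold hypotheses are replaced by five explicit `|U|`-smallness conditions (the multiplier's scale constants enter
as `α_k·Λ_j^k`, `|U|`-free for sector data `α_k ≍ κ_kᴾ/Λ_j^k`).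

* **`rowSum_klScaleWt_flowOsc_telescope_le_cd`** — the (K5′) SUM form `rows(K̊_{m₀+d}, μ′) ≤ base(K̊_{m₀}, μ′) + d·8Σ_{ω′}(Λ_j/ρ)Π̂_j√(24·2M·L²N_s)·2c₀K₁·c″U²`
  under `U₀`-type conditions only (plus the level time condition and the two `m`-free rate conditions).

Everything is proved; no definitions, no sorry.  Nothing asserts superconductivity.
-/

noncomputable section

namespace Summit.HubbardSuperconductivity.HubbardSuperconductivity.Theorems.EngineV8

set_option linter.dupNamespace false -- summit = problem name (single-conjunct summit), D-0017

open Real Finset Literature.MathematicalPhysics.QuantumLattice Literature.Probability.LatticeModels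
open Summit.HubbardSuperconductivity.HubbardSuperconductivity.Theorems.DispersionFlow
open Summit.HubbardSuperconductivity.HubbardSuperconductivity.Theorems.KLRegimeSplit
open Summit.HubbardSuperconductivity.HubbardSuperconductivity.Theorems.TorusFourierL2
open Summit.HubbardSuperconductivity.HubbardSuperconductivity.Theorems.KLProgrammeLegKernels

variable {L M : ℕ} [NeZero L] [NeZero M]

/-- **The (K5′) SUM form at the (c-D) depth — thresholds discharged**: `rowSum_klScaleWt_flowOsc_telescope_le` for the slice at level `j`
(`Λ = Λ_j = klScale klE0 j`), base depth `m₀ ≥ 2j + 5 + ⌈log₄(U²)⁻¹⌉₊` (= `klCDBase U j`), with the five threshold conditions replaced by the five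
EXPLICIT `|U|`-smallness conditions of `…EngineCDThresholdsLow/X3` (`u·S ≤ 1024^i κ₁ g e₀^{2i}`, `|U| ≤ 1`): the statement the tower instantiates at
`μ′ = μ + s_n`. [cite: BenfattoGiulianiMastropietro2006, §2.7 (2.66)–(2.67), §3 (3.2)–(3.8)] -/
theorem rowSum_klScaleWt_flowOsc_telescope_le_cd {β U μ μ' Λ' c'' : ℝ} {R : RenConsts} {N : ℕ} (j : ℕ) (hβ : 0 < β) (hΛΛ' : klScale klE0 j ≤ Λ')
    (hM : Λ' < π * (2 * M - 5) / β) (hR : ∀ j, 0 ≤ R.Gfr j) (hc : 0 ≤ c'') (hU0 : 0 < |U|) (hU1 : |U| ≤ 1) {m₀ d : ℕ}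
    (hm₀ : 2 * j + 5 + ⌈Real.logb 4 (U ^ 2)⁻¹⌉₊ ≤ m₀) (hJ : ∀ m' < m₀ + d, FlowPieceJetsAt L M β U μ R m')
    (hO : ∀ m' < m₀ + d, FlowPieceOscAt L M c'' β U μ m')
    {G₀ G₁ G₂ G₃ b₁ b₂ b₂' b₃ b₃' : ℝ} (hG₀ : G₀ = c'' * |U| * uPow 0 U) (hG₁ : G₁ = R.Gfr 1 * uPow 1 U) (hG₂ : G₂ = R.Gfr 2 * uPow 2 U)
    (hG₃ : G₃ = R.Gfr 3 * uPow 3 U) (hb₁ : b₁ = 4 + 4 / 3 * (R.Gfr 1 * uPow 1 U)) (hb₂ : b₂ = 16) (hb₂' : b₂' = R.Gfr 2 * uPow 2 U)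
    (hb₃ : b₃ = 64) (hb₃' : b₃' = R.Gfr 3 * uPow 3 U / 3)
    {B₁ B₂ B₃ B₄ : ℝ} (hB₁ : ∀ x, |deriv salmhoferCutoff x| ≤ B₁) (hB₂ : ∀ x, |deriv (deriv salmhoferCutoff) x| ≤ B₂)
    (hB₃ : ∀ x, |deriv (deriv (deriv salmhoferCutoff)) x| ≤ B₃) (hB₄ : ∀ x, |deriv (deriv (deriv (deriv salmhoferCutoff))) x| ≤ B₄)
    -- the sector multipliers: per pair, sup, support, time differences, space differences in scale form
    (F : Fin N → FreqMomentum L M → ℂ) (hF0 : ∀ ω ω' (q : TorusSite 1 (2 * M) × TorusSite 2 L), ‖F ω (⟨(q.1 0).val, ZMod.val_lt (q.1 0)⟩, q.2) * F ω' (⟨(q.1 0).val, ZMod.val_lt (q.1 0)⟩, q.2)‖ ≤ 1)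
    {Ns : Fin N → Fin N → ℕ} (hsupp : ∀ ω ω', (univ.filter fun q : TorusSite 1 (2 * M) × TorusSite 2 L => F ω (⟨(q.1 0).val, ZMod.val_lt (q.1 0)⟩, q.2) * F ω' (⟨(q.1 0).val, ZMod.val_lt (q.1 0)⟩, q.2) ≠ 0).card ≤ Ns ω ω')
    (v : Fin N → Fin 2 → ℤ) (hv : ∀ ω, v ω ≠ 0)
    {at₁ at₂ at₃ : ℝ} (hat₁ : 0 ≤ at₁) (hat₂ : 0 ≤ at₂) (hat₃ : 0 ≤ at₃)
    (hMt₁ : ∀ ω ω' q, ‖fwdDiff ((fun _ : Fin 1 => (1 : ZMod (2 * M))), (0 : TorusSite 2 L)) (fun q : TorusSite 1 (2 * M) × TorusSite 2 L => F ω (⟨(q.1 0).val, ZMod.val_lt (q.1 0)⟩, q.2) * F ω' (⟨(q.1 0).val, ZMod.val_lt (q.1 0)⟩, q.2)) q‖ ≤ at₁)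
    (hMt₂ : ∀ ω ω' q, ‖(fwdDiff ((fun _ : Fin 1 => (1 : ZMod (2 * M))), (0 : TorusSite 2 L)))^[2] (fun q : TorusSite 1 (2 * M) × TorusSite 2 L => F ω (⟨(q.1 0).val, ZMod.val_lt (q.1 0)⟩, q.2) * F ω' (⟨(q.1 0).val, ZMod.val_lt (q.1 0)⟩, q.2)) q‖ ≤ at₂)
    (hMt₃ : ∀ ω ω' q, ‖(fwdDiff ((fun _ : Fin 1 => (1 : ZMod (2 * M))), (0 : TorusSite 2 L)))^[3] (fun q : TorusSite 1 (2 * M) × TorusSite 2 L => F ω (⟨(q.1 0).val, ZMod.val_lt (q.1 0)⟩, q.2) * F ω' (⟨(q.1 0).val, ZMod.val_lt (q.1 0)⟩, q.2)) q‖ ≤ at₃)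
    {α₁ α₂ α₃ : ℝ} (hα₁ : 0 ≤ α₁) (hα₂ : 0 ≤ α₂) (hα₃ : 0 ≤ α₃)
    (hMe₁ : ∀ ω ω' q (i : Fin 2), ‖fwdDiff ((0 : TorusSite 1 (2 * M)), (Pi.single i (1 : ZMod L) : TorusSite 2 L)) (fun q : TorusSite 1 (2 * M) × TorusSite 2 L => F ω (⟨(q.1 0).val, ZMod.val_lt (q.1 0)⟩, q.2) * F ω' (⟨(q.1 0).val, ZMod.val_lt (q.1 0)⟩, q.2)) q‖ ≤
      α₁ * ‖(WithLp.toLp 2 (fun j => 2 * π / L * ((Pi.single i (1 : ℤ) : Fin 2 → ℤ) j : ℝ)) : EuclideanSpace ℝ (Fin 2))‖)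
    (hMe₂ : ∀ ω ω' q (i : Fin 2), ‖(fwdDiff ((0 : TorusSite 1 (2 * M)), (Pi.single i (1 : ZMod L) : TorusSite 2 L)))^[2] (fun q : TorusSite 1 (2 * M) × TorusSite 2 L => F ω (⟨(q.1 0).val, ZMod.val_lt (q.1 0)⟩, q.2) * F ω' (⟨(q.1 0).val, ZMod.val_lt (q.1 0)⟩, q.2)) q‖ ≤
      α₂ * ‖(WithLp.toLp 2 (fun j => 2 * π / L * ((Pi.single i (1 : ℤ) : Fin 2 → ℤ) j : ℝ)) : EuclideanSpace ℝ (Fin 2))‖ ^ 2)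
    (hMe₃ : ∀ ω ω' q (i : Fin 2), ‖(fwdDiff ((0 : TorusSite 1 (2 * M)), (Pi.single i (1 : ZMod L) : TorusSite 2 L)))^[3] (fun q : TorusSite 1 (2 * M) × TorusSite 2 L => F ω (⟨(q.1 0).val, ZMod.val_lt (q.1 0)⟩, q.2) * F ω' (⟨(q.1 0).val, ZMod.val_lt (q.1 0)⟩, q.2)) q‖ ≤
      α₃ * ‖(WithLp.toLp 2 (fun j => 2 * π / L * ((Pi.single i (1 : ℤ) : Fin 2 → ℤ) j : ℝ)) : EuclideanSpace ℝ (Fin 2))‖ ^ 3)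
    (hMn₁ : ∀ ω ω' q, ‖fwdDiff ((0 : TorusSite 1 (2 * M)), (fun j => ((![-(v ω) 1, (v ω) 0] j : ℤ) : ZMod L))) (fun q : TorusSite 1 (2 * M) × TorusSite 2 L => F ω (⟨(q.1 0).val, ZMod.val_lt (q.1 0)⟩, q.2) * F ω' (⟨(q.1 0).val, ZMod.val_lt (q.1 0)⟩, q.2)) q‖ ≤
      α₁ * ‖(WithLp.toLp 2 (fun j => 2 * π / L * ((![-(v ω) 1, (v ω) 0] : Fin 2 → ℤ) j : ℝ)) : EuclideanSpace ℝ (Fin 2))‖)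
    (hMn₂ : ∀ ω ω' q, ‖(fwdDiff ((0 : TorusSite 1 (2 * M)), (fun j => ((![-(v ω) 1, (v ω) 0] j : ℤ) : ZMod L))))^[2] (fun q : TorusSite 1 (2 * M) × TorusSite 2 L => F ω (⟨(q.1 0).val, ZMod.val_lt (q.1 0)⟩, q.2) * F ω' (⟨(q.1 0).val, ZMod.val_lt (q.1 0)⟩, q.2)) q‖ ≤
      α₂ * ‖(WithLp.toLp 2 (fun j => 2 * π / L * ((![-(v ω) 1, (v ω) 0] : Fin 2 → ℤ) j : ℝ)) : EuclideanSpace ℝ (Fin 2))‖ ^ 2)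
    (hMn₃ : ∀ ω ω' q, ‖(fwdDiff ((0 : TorusSite 1 (2 * M)), (fun j => ((![-(v ω) 1, (v ω) 0] j : ℤ) : ZMod L))))^[3] (fun q : TorusSite 1 (2 * M) × TorusSite 2 L => F ω (⟨(q.1 0).val, ZMod.val_lt (q.1 0)⟩, q.2) * F ω' (⟨(q.1 0).val, ZMod.val_lt (q.1 0)⟩, q.2)) q‖ ≤
      α₃ * ‖(WithLp.toLp 2 (fun j => 2 * π / L * ((![-(v ω) 1, (v ω) 0] : Fin 2 → ℤ) j : ℝ)) : EuclideanSpace ℝ (Fin 2))‖ ^ 3)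
    (hMv₁ : ∀ ω ω' q, ‖fwdDiff ((0 : TorusSite 1 (2 * M)), (fun j => (((v ω) j : ℤ) : ZMod L))) (fun q : TorusSite 1 (2 * M) × TorusSite 2 L => F ω (⟨(q.1 0).val, ZMod.val_lt (q.1 0)⟩, q.2) * F ω' (⟨(q.1 0).val, ZMod.val_lt (q.1 0)⟩, q.2)) q‖ ≤
      α₁ * ‖(WithLp.toLp 2 (fun j => 2 * π / L * ((v ω) j : ℝ)) : EuclideanSpace ℝ (Fin 2))‖)
    (hMv₂ : ∀ ω ω' q, ‖(fwdDiff ((0 : TorusSite 1 (2 * M)), (fun j => (((v ω) j : ℤ) : ZMod L))))^[2] (fun q : TorusSite 1 (2 * M) × TorusSite 2 L => F ω (⟨(q.1 0).val, ZMod.val_lt (q.1 0)⟩, q.2) * F ω' (⟨(q.1 0).val, ZMod.val_lt (q.1 0)⟩, q.2)) q‖ ≤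
      α₂ * ‖(WithLp.toLp 2 (fun j => 2 * π / L * ((v ω) j : ℝ)) : EuclideanSpace ℝ (Fin 2))‖ ^ 2)
    (hMv₃ : ∀ ω ω' q, ‖(fwdDiff ((0 : TorusSite 1 (2 * M)), (fun j => (((v ω) j : ℤ) : ZMod L))))^[3] (fun q : TorusSite 1 (2 * M) × TorusSite 2 L => F ω (⟨(q.1 0).val, ZMod.val_lt (q.1 0)⟩, q.2) * F ω' (⟨(q.1 0).val, ZMod.val_lt (q.1 0)⟩, q.2)) q‖ ≤
      α₃ * ‖(WithLp.toLp 2 (fun j => 2 * π / L * ((v ω) j : ℝ)) : EuclideanSpace ℝ (Fin 2))‖ ^ 3)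
    -- the level `j` (weight rates `klScale klE0 j_jβ/(2M), klScale klE0 j_j`), the piece rates `ρ, ρ₃`, the time condition, the thresholds AT `m₀`, the rate conditions
    {ρ ρ₃ k₁ k₂ k₃ k₄ : ℝ} (hρ : 0 < ρ) (hρ₃ : 0 < ρ₃) (hSρ : ρ ≤ klScale klE0 j * (4 : ℝ) ^ m₀)
    (hk₁ : k₁ = (16 * B₁ + 16) / klScale klE0 j ^ 2) (hk₂ : k₂ = (32 * B₂ + 144 * B₁ + 128) / klScale klE0 j ^ 3)
    (hk₃ : k₃ = (64 * B₃ + 480 * B₂ + 1728 * B₁ + 1536) / klScale klE0 j ^ 4)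
    (hk₄ : k₄ = (128 * B₄ + 1408 * B₃ + 7776 * B₂ + 27648 * B₁ + 24576) / klScale klE0 j ^ 5)
    (ht : (2 * π / β) ^ 3 * ((128 * B₄ + 1216 * B₃ + 6912 * B₂ + 26112 * B₁ + 24576) * (β * (L : ℝ) ^ 2) / klScale klE0 j ^ 5) +
          3 * (at₁ * ((2 * π / β) ^ 2 * ((64 * B₃ + 416 * B₂ + 1600 * B₁ + 1536) * (β * (L : ℝ) ^ 2) / klScale klE0 j ^ 4))) +
          3 * (at₂ * ((2 * π / β) * ((32 * B₂ + 128 * B₁ + 128) * (β * (L : ℝ) ^ 2) / klScale klE0 j ^ 3))) + at₃ * ((16 * B₁ + 16) * (β * (L : ℝ) ^ 2) / klScale klE0 j ^ 2) ≤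
      2 * ((16 * B₁ + 16) * (β * (L : ℝ) ^ 2) / klScale klE0 j ^ 2) * (4 / (klScale klE0 j * β / (2 * M) * (2 * M : ℕ))) ^ 3)
    (hUX1 : 3 * (|U| * (3 * b₂' * R.Gfr 1 * (32 * B₂ + 144 * B₁ + 128) * klE0 + 3 * (α₁ * klScale klE0 j) * R.Gfr 2 * (16 * B₁ + 16) * klE0 + 3 * b₁ * R.Gfr 2 * (32 * B₂ + 144 * B₁ + 128) * klE0)) ≤
      1024 * (16 * B₁ + 16) * R.Gfr 3 * klE0 ^ 2)
    (hUX2 : 3 * (|U| * (3 * (α₁ * klScale klE0 j) * b₂' * (c'' * |U|) * (32 * B₂ + 144 * B₁ + 128) * klE0 ^ 2 + 3 * b₁ * b₂' * (c'' * |U|) * (64 * B₃ + 480 * B₂ + 1728 * B₁ + 1536) * klE0 ^ 2 + 6 * (α₁ * klScale klE0 j) * b₁ * R.Gfr 1 * (32 * B₂ + 144 * B₁ + 128) * klE0 ^ 2 + 3 * b₁ ^ 2 * R.Gfr 1 * (64 * B₃ + 480 * B₂ + 1728 * B₁ + 1536) * klE0 ^ 2 + (c'' * |U|) * R.Gfr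 3 * (32 * B₂ + 144 * B₁ + 128) * klE0 ^ 3 + b₃' * (c'' * |U|) * (32 * B₂ + 144 * B₁ + 128) * klE0 ^ 3 + 3 * R.Gfr 1 * R.Gfr 2 * (32 * B₂ + 144 * B₁ + 128) * klE0 ^ 3 + 3 * (α₂ * klScale klE0 j ^ 2) * R.Gfr 1 * (16 * B₁ + 16) * klE0 ^ 2 + 3 * b₂ * R.Gfr 1 * (32 * B₂ + 144 * B₁ + 128) * klE0 ^ 3)) ≤
      1048576 * (16 * B₁ + 16) * R.Gfr 3 * klE0 ^ 4)
    (hUX3 : 3 * (|U| * (3 * (α₁ * klScale klE0 j) * b₁ ^ 2 * (c'' * |U|) * (64 * B₃ + 480 * B₂ + 1728 * B₁ + 1536) * klE0 ^ 3 + b₁ ^ 3 * (c'' * |U|) * (128 * B₄ + 1408 * B₃ + 7776 * B₂ + 27648 * B₁ + 24576) * klE0 ^ 3 + 3 * b₂' * (c'' * |U|) * R.Gfr 1 * (64 * B₃ + 480 * B₂ + 1728 * B₁ + 1536) * klE0 ^ 4 + 3 * (α₁ * klScale klE0 j) * (c'' * |U|) * R.Gfr 2 * (32 * B₂ + 144 *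 B₁ + 128) * klE0 ^ 4 + 3 * b₁ * (c'' * |U|) * R.Gfr 2 * (64 * B₃ + 480 * B₂ + 1728 * B₁ + 1536) * klE0 ^ 4 + 3 * (α₁ * klScale klE0 j) * b₂ * (c'' * |U|) * (32 * B₂ + 144 * B₁ + 128) * klE0 ^ 4 + 3 * (α₂ * klScale klE0 j ^ 2) * b₁ * (c'' * |U|) * (32 * B₂ + 144 * B₁ + 128) * klE0 ^ 3 + 3 * b₁ * b₂ * (c'' * |U|) * (64 * B₃ + 480 * B₂ + 1728 * B₁ + 1536) * klE0 ^ 4 + 3 * (α₁ * klScale klE0 j) * R.Gfr 1 ^ 2 * (32 * B₂ + 144 * B₁ + 128) * klE0 ^ 4 + 3 * b₁ * R.Gfr 1 ^ 2 * (64 * B₃ + 480 * B₂ + 1728 * B₁ + 1536) * klE0 ^ 4 + (α₃ * klScale klE0 j ^ 3) * (c'' * |U|) * (16 * B₁ + 16) * klE0 ^ 3 + b₃ * (c'' * |U|) * (32 * B₂ + 144 * B₁ + 128) * klE0 ^ 5 + 6 * (α₁ * klScale klE0 j) * b₁ * (c'' * |U|) * R.Gfr 1 * (64 * B₃ + 480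 * B₂ + 1728 * B₁ + 1536) * klE0 ^ 3 + 3 * b₁ ^ 2 * (c'' * |U|) * R.Gfr 1 * (128 * B₄ + 1408 * B₃ + 7776 * B₂ + 27648 * B₁ + 24576) * klE0 ^ 3 + 3 * (c'' * |U|) * R.Gfr 1 * R.Gfr 2 * (64 * B₃ + 480 * B₂ + 1728 * B₁ + 1536) * klE0 ^ 4 + 3 * (α₂ * klScale klE0 j ^ 2) * (c'' * |U|) * R.Gfr 1 * (32 * B₂ + 144 * B₁ + 128) * klE0 ^ 3 + 3 * b₂ * (c'' * |U|) * R.Gfr 1 * (64 * B₃ + 480 * B₂ + 1728 * B₁ + 1536) * klE0 ^ 4 + R.Gfr 1 ^ 3 * (64 * B₃ + 480 * B₂ + 1728 * B₁ + 1536) * klE0 ^ 4 + 3 * (α₁ * klScale klE0 j) * (c'' * |U|) * R.Gfr 1 ^ 2 * (64 * B₃ + 480 * B₂ + 1728 * B₁ + 1536) * klE0 ^ 3 + 3 * b₁ * (c'' * |U|) * R.Gfr 1 ^ 2 * (128 * B₄ + 1408 * B₃ + 7776 * B₂ + 27648 * B₁ + 24576) * klE0 ^ 3 + (c'' * |U|)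 * R.Gfr 1 ^ 3 * (128 * B₄ + 1408 * B₃ + 7776 * B₂ + 27648 * B₁ + 24576) * klE0 ^ 3)) ≤
      1073741824 * (16 * B₁ + 16) * R.Gfr 3 * klE0 ^ 6)
    (hUY1 : 2 * (|U| * (b₂' * (c'' * |U|) * (32 * B₂ + 144 * B₁ + 128) * klE0 + 2 * (α₁ * klScale klE0 j) * R.Gfr 1 * (16 * B₁ + 16) * klE0 + 2 * b₁ * R.Gfr 1 * (32 * B₂ + 144 * B₁ + 128) * klE0)) ≤
      1024 * (16 * B₁ + 16) * R.Gfr 2 * klE0 ^ 2)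
    (hUY2 : 2 * (|U| * (2 * (α₁ * klScale klE0 j) * b₁ * (c'' * |U|) * (32 * B₂ + 144 * B₁ + 128) * klE0 ^ 2 + b₁ ^ 2 * (c'' * |U|) * (64 * B₃ + 480 * B₂ + 1728 * B₁ + 1536) * klE0 ^ 2 + (c'' * |U|) * R.Gfr 2 * (32 * B₂ + 144 * B₁ + 128) * klE0 ^ 3 + (α₂ * klScale klE0 j ^ 2) * (c'' * |U|) * (16 * B₁ + 16) * klE0 ^ 2 + b₂ * (c'' * |U|) * (32 * B₂ + 144 * B₁ + 128) * klE0 ^ 3 + R.Gfr 1 ^ 2 * (32 * B₂ + 144 * B₁ + 128) * klE0 ^ 3 + 2 * (α₁ * klScale klE0 j) * (c'' * |U|) * R.Gfr 1 * (32 * B₂ + 144 * B₁ + 128) * klE0 ^ 2 + 2 * b₁ * (c'' * |U|) * R.Gfr 1 * (64 * B₃ + 480 * B₂ + 1728 * B₁ + 1536) * klE0 ^ 2 + (c'' * |U|) * R.Gfr 1 ^ 2 * (64 * B₃ + 480 * B₂ + 1728 * B₁ + 1536) * klE0 ^ 2)) ≤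
      1048576 * (16 * B₁ + 16) * R.Gfr 2 * klE0 ^ 4)
    (hrate₃ : G₃ * ρ ^ 3 ≤ (2 / π) ^ 3 * G₀) (hrate₂ : G₂ * ρ₃ ^ 2 ≤ (2 / π) ^ 2 * G₀)
    (Y : SpaceTimeIdx L M × SectorLeg N) :
    ∑ Y' : SpaceTimeIdx L M × SectorLeg N,
        ‖((sectorSubMatrix L M β F).transpose * hubbardCovSliceCT L M β μ' 0 (fsub (klFlowFrameU L M β U μ (m₀ + d)) (symInterp L fun _ => -(∑ m' ∈ range (m₀ + d), klAngularMean (klLocalPart L M β U μ (klFlowFrameU L M β U μ m') m')))) (klScale klE0 j) Λ' *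
            sectorSubMatrix L M β F) Y Y'‖ *
          klScaleWt L M β j {latticeLegPos (2 * (2 * M)) Y, latticeLegPos (2 * (2 * M)) Y'} ≤
      8 * ∑ ω' : Fin N, ∑ z : TorusSite 1 (2 * M) × TorusSite 2 L, (1 + klScale klE0 j * β / (2 * M) * |(((z.1 0).valMinAbs : ℤ) : ℝ)| + klScale klE0 j * |(((z.2 0).valMinAbs : ℤ) : ℝ)| + klScale klE0 j * |(((z.2 1).valMinAbs : ℤ) : ℝ)|) *
        ‖∑ q : TorusSite 1 (2 * M) × TorusSite 2 L, (torusChar q.1 z.1 * torusChar q.2 z.2) •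
          ((((1 / (β * (L : ℝ) ^ 2) : ℝ) : ℂ) ^ 2 *
            (F Y.2.1.1 (⟨(q.1 0).val, ZMod.val_lt (q.1 0)⟩, q.2) * F ω' (⟨(q.1 0).val, ZMod.val_lt (q.1 0)⟩, q.2) *
              sliceSymbolFnXi (β * (L : ℝ) ^ 2) 0 (klScale klE0 j) Λ' (matsubaraFreq β M ⟨(q.1 0).val, ZMod.val_lt (q.1 0)⟩)
                (nambuXiCT L μ' ((fsub (klFlowFrameU L M β U μ m₀) (symInterp L fun _ => -(∑ m' ∈ range m₀, klAngularMean (klLocalPart L M β U μ (klFlowFrameU L M β U μ m') m'))))) q.2))))‖ +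
      (d : ℝ) * (8 * ∑ ω' : Fin N, klScale klE0 j / ρ * Real.sqrt (524288 * (1 / (klScale klE0 j * β / (2 * M)) + 1) * ((1 + 4 * Real.sqrt 2) ^ 2 * ((2 * Real.sqrt 2 / ρ + 2) * (2 * Real.sqrt 2 / ρ₃ + 2)) + (1 / ρ + 1) ^ 2)) *
        Real.sqrt (24 * (2 * M : ℕ) * (L : ℝ) ^ 2 * Ns Y.2.1.1 ω') * (2 * ((1 / (β * (L : ℝ) ^ 2)) ^ 2 * ((16 * B₁ + 16) * (β * (L : ℝ) ^ 2) / klScale klE0 j ^ 2 * G₀)))) := by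
  have hΛj : 0 < klScale klE0 j := klth_klScale_pos j
  have he : 0 < klE0 := by have h := klth_klScale_pos 0; rwa [klScale, pow_zero, inv_one, mul_one] at h
  have hΛe : klScale klE0 j ≤ klE0 := by
    rw [klScale]; exact mul_le_of_le_one_right he.le (inv_le_one_of_one_le₀ (one_le_pow₀ (by norm_num)))
  have hB10 : 0 ≤ B₁ := (abs_nonneg _).trans (hB₁ 0)
  have hB20 : 0 ≤ B₂ := (abs_nonneg _).trans (hB₂ 0)
  have hB30 : 0 ≤ B₃ := (abs_nonneg _).trans (hB₃ 0)
  have hB40 : 0 ≤ B₄ := (abs_nonneg _).trans (hB₄ 0)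
  have hκ₁ : 0 ≤ (16 * B₁ + 16) := by positivity
  have hκ₂ : 0 ≤ (32 * B₂ + 144 * B₁ + 128) := by positivity
  have hκ₃ : 0 ≤ (64 * B₃ + 480 * B₂ + 1728 * B₁ + 1536) := by positivity
  have hκ₄ : 0 ≤ (128 * B₄ + 1408 * B₃ + 7776 * B₂ + 27648 * B₁ + 24576) := by positivity
  have hg₀ : 0 ≤ c'' * |U| := by positivity
  have ha₁ : 0 ≤ α₁ * klScale klE0 j := by positivity
  have ha₂ : 0 ≤ α₂ * klScale klE0 j ^ 2 := by positivity
  have ha₃ : 0 ≤ α₃ * klScale klE0 j ^ 3 := by positivity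
  have hu : ∀ i, 0 ≤ uPow i U := fun i => by unfold uPow; split_ifs <;> positivity
  have hb₁0 : 0 ≤ b₁ := by rw [hb₁]; have := mul_nonneg (hR 1) (hu 1); positivity
  have hb₂0 : 0 ≤ b₂ := by rw [hb₂]; norm_num
  have hb₂'0 : 0 ≤ b₂' := by rw [hb₂']; exact mul_nonneg (hR 2) (hu 2)
  have hb₃0 : 0 ≤ b₃ := by rw [hb₃]; norm_num
  have hb₃'0 : 0 ≤ b₃' := by rw [hb₃']; exact div_nonneg (mul_nonneg (hR 3) (hu 3)) (by norm_num)
  have hsq : U ^ 2 = |U| ^ 2 := (sq_abs U).symm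
  have hG₀' : G₀ = c'' * |U| * |U| := by rw [hG₀]; simp [uPow]
  have hG₁' : G₁ = R.Gfr 1 * |U| ^ 2 := by rw [hG₁, ← hsq]; simp [uPow]
  have hG₂' : G₂ = R.Gfr 2 * |U| ^ 2 := by rw [hG₂, ← hsq]; simp [uPow]
  have hG₃' : G₃ = R.Gfr 3 * |U| ^ 2 := by rw [hG₃, ← hsq]; simp [uPow]
  have hα₁' : α₁ = α₁ * klScale klE0 j / klScale klE0 j := by field_simp
  have hα₂' : α₂ = α₂ * klScale klE0 j ^ 2 / klScale klE0 j ^ 2 := by field_simp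
  have hα₃' : α₃ = α₃ * klScale klE0 j ^ 3 / klScale klE0 j ^ 3 := by field_simp
  have hx : 1024 * klE0 ^ 2 ≤ (4 : ℝ) ^ m₀ * (|U| ^ 2 * klScale klE0 j ^ 2) := by
    have h := cd_depth_lower he hU0 hU1 hm₀
    rwa [klScale]
  have hX1 := cd_threshold_X1 (hκ₁ := hκ₁) (hκ₂ := hκ₂) (hg₁ := (hR 1)) (hg₂ := (hR 2)) (hg₃ := (hR 3)) (ha₁ := ha₁) (hb₁ := hb₁0) (hb₂' := hb₂'0) (hΛ := hΛj) (hΛe := hΛe) (hu0 := hU0) (hu1 := hU1) (hx := hx) (hk₁ := hk₁) (hk₂ := hk₂) (hG₁ := hG₁') (hG₂ := hG₂') (hG₃ := hG₃') (hα₁ := hα₁') (hU := hUX1)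
  have hX2 := cd_threshold_X2 (hκ₁ := hκ₁) (hκ₂ := hκ₂) (hκ₃ := hκ₃) (hg₀ := hg₀) (hg₁ := (hR 1)) (hg₂ := (hR 2)) (hg₃ := (hR 3)) (ha₁ := ha₁) (ha₂ := ha₂) (hb₁ := hb₁0) (hb₂ := hb₂0) (hb₂' := hb₂'0) (hb₃' := hb₃'0) (hΛ := hΛj) (hΛe := hΛe) (hu0 := hU0) (hu1 := hU1) (hx := hx) (hk₁ := hk₁) (hk₂ := hk₂) (hk₃ := hk₃) (hG₀ := hG₀') (hG₁ := hG₁') (hG₂ := hG₂') (hG₃ := hG₃') (hα₁ := hα₁') (hα₂ := hα₂') (hU := hUX2)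
  have hX3 := cd_threshold_X3 (hκ₁ := hκ₁) (hκ₂ := hκ₂) (hκ₃ := hκ₃) (hκ₄ := hκ₄) (hg₀ := hg₀) (hg₁ := (hR 1)) (hg₂ := (hR 2)) (hg₃ := (hR 3)) (ha₁ := ha₁) (ha₂ := ha₂) (ha₃ := ha₃) (hb₁ := hb₁0) (hb₂ := hb₂0) (hb₂' := hb₂'0) (hb₃ := hb₃0) (hΛ := hΛj) (hΛe := hΛe) (hu0 := hU0) (hu1 := hU1) (hx := hx) (hk₁ := hk₁) (hk₂ := hk₂) (hk₃ := hk₃) (hk₄ := hk₄) (hG₀ := hG₀') (hG₁ := hG₁') (hG₂ := hG₂') (hG₃ := hG₃') (hα₁ := hα₁') (hα₂ := hα₂') (hα₃ := hα₃') (hU := hUX3)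
  have hY1 := cd_threshold_Y1 (hκ₁ := hκ₁) (hκ₂ := hκ₂) (hg₀ := hg₀) (hg₁ := (hR 1)) (hg₂ := (hR 2)) (ha₁ := ha₁) (hb₁ := hb₁0) (hb₂' := hb₂'0) (hΛ := hΛj) (hΛe := hΛe) (hu0 := hU0) (hu1 := hU1) (hx := hx) (hk₁ := hk₁) (hk₂ := hk₂) (hG₀ := hG₀') (hG₁ := hG₁') (hG₂ := hG₂') (hα₁ := hα₁') (hU := hUY1)
  have hY2 := cd_threshold_Y2 (hκ₁ := hκ₁) (hκ₂ := hκ₂) (hκ₃ := hκ₃) (hg₀ := hg₀) (hg₁ := (hR 1)) (hg₂ := (hR 2)) (ha₁ := ha₁) (ha₂ := ha₂) (hb₁ := hb₁0) (hb₂ := hb₂0) (hΛ := hΛj) (hΛe := hΛe) (hu0 := hU0) (hu1 := hU1) (hx := hx) (hk₁ := hk₁) (hk₂ := hk₂) (hk₃ := hk₃) (hG₀ := hG₀') (hG₁ := hG₁') (hG₂ := hG₂') (hα₁ := hα₁') (hα₂ := hα₂') (hU := hUY2)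
  exact rowSum_klScaleWt_flowOsc_telescope_le (L := L) (M := M) hβ hΛj hΛΛ' hM hR hJ hO hG₀ hG₁ hG₂ hG₃ hb₁ hb₂ hb₂' hb₃ hb₃' hB₁ hB₂ hB₃ hB₄ F hF0 hsupp v hv
    hat₁ hat₂ hat₃ hMt₁ hMt₂ hMt₃ hα₁ hα₂ hα₃ hMe₁ hMe₂ hMe₃ hMn₁ hMn₂ hMn₃ hMv₁ hMv₂ hMv₃ j hρ hρ₃ hSρ hk₁ hk₂ hk₃ hk₄ ht hX1 hX2 hX3 hY1 hY2
    hrate₃ hrate₂ Y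

end Summit.HubbardSuperconductivity.HubbardSuperconductivity.Theorems.EngineV8

end
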